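import Summits.CriticalPhenomena.CardyFormulaZ2.Theorems.CardyQContinuationJetLimitLemma
import Summits.CriticalPhenomena.CardyFormulaZ2.Theorems.CardyQContinuationFirstJetAtOneBounded

/-!
# Route `CardyQContinuation` — the assembly (item stmt-CriticalPhenomena-5564)

`Assembly : UniformZeroFree → IsingJetsConformal → BernoulliMatch → JetLimitLemma → CardyRigidity →
CardyFormulaZ2` for route `route-CriticalPhenomena-CardyQContinuation` (sub-problem
`CardyFormulaZ2`).

Proof (the route's own assembly paragraph, made formal).  Write `T_ρ` for the complex
`ρ`-neighbourhood of the segment `[1, √2]` and `P_δ = N_δ / Z_δ` for the self-dual crossing ratio of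
the conformal rectangle `R`.

* `UniformZeroFree` gives `ρ, M` with `Z_δ ≠ 0` and `‖P_δ‖ ≤ M` on `T_ρ` for all small `δ`; since
  `N_δ, Z_δ` are finite sums of monomials (`finite_powerset_edgeSet`), `P_δ` is holomorphic on
  `T_ρ` for the same `δ`.
* `IsingJetsConformal` gives the convergence of every `s`-jet of `P_δ` at `√2 ∈ T_ρ` to
  `c n η`, `η` the cross-ratio of a uniformizing datum of `R`; `JetLimitLemma` then yields a
  holomorphic `g_R` on `T_ρ` with jets `c n η` at `√2` and `P_δ(z) → g_R(z)` on `T_ρ`, in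
  particular at `z = 1`, where `BernoulliMatch` identifies `P_δ(1)` with
  `bondDomainCrossingProb R δ`: the percolation crossing probabilities of `R` converge to
  `Re g_R(1)`.
* Two rectangles with data of the same cross-ratio have `g`'s with the same jets at `√2`, hence
  equal on the common (convex) thickening by the identity theorem in jet form
  (`JetLimit.eqOn_of_forall_iteratedDeriv_eq`), so the limit is a function `f` of the cross-ratio
  alone: `∀ R, R.HasCrossingLimit (bondDomainCrossingProb R) f`.
* `CardyRigidity` identifies `f` with `cardyFunction` on `(0, 1)`, where every cross-ratio of a
  uniformizing datum lies (`crossRatio_mem_Ioo_of_isUniformizing`).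
-/

noncomputable section

open Filter Set Metric Topology
open Literature.Probability.LatticeModels Literature.Probability.Percolation
open Literature.Probability.RandomPlanarGeometry
open Summit.CriticalPhenomena.CardyFormulaZ2.Theorems.CardyQContinuation

namespace Summit.CriticalPhenomena.CardyFormulaZ2.Theorems

namespace CardyQContinuationAssembly

/-- Real points of `[1, √2]` lie in every thickened segment `T_ρ`, `ρ > 0`. [folklore] -/
theorem ofReal_mem_thickening_segment {ρ : ℝ} (hρ : 0 < ρ) {t : ℝ}
    (ht : t ∈ Set.Icc (1:ℝ) (Real.sqrt 2)) :
    (t : ℂ) ∈ Metric.thickening ρ (((↑) : ℝ → ℂ) '' Set.Icc (1:ℝ) (Real.sqrt 2)) :=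
  Metric.self_subset_thickening hρ _ ⟨t, ht, rfl⟩

/-- `√2 ∈ T_ρ` for `ρ > 0`. [folklore] -/
theorem sqrt_two_mem_thickening_segment {ρ : ℝ} (hρ : 0 < ρ) :
    ((Real.sqrt 2 : ℝ) : ℂ) ∈ Metric.thickening ρ (((↑) : ℝ → ℂ) '' Set.Icc (1:ℝ) (Real.sqrt 2)) :=
  ofReal_mem_thickening_segment hρ ⟨Real.one_lt_sqrt_two.le, le_rfl⟩

/-- `1 ∈ T_ρ` for `ρ > 0`. [folklore] -/
theorem one_mem_thickening_segment {ρ : ℝ} (hρ : 0 < ρ) :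
    (1 : ℂ) ∈ Metric.thickening ρ (((↑) : ℝ → ℂ) '' Set.Icc (1:ℝ) (Real.sqrt 2)) := by
  have h := ofReal_mem_thickening_segment hρ ⟨le_rfl, Real.one_lt_sqrt_two.le⟩
  simpa using h

/-- **Jets at one point determine a holomorphic function on the thickened segment**: two functions
holomorphic on `T_ρ₁`, `T_ρ₂` with the same jets at a point of `T_{min ρ₁ ρ₂}` agree on
`T_{min ρ₁ ρ₂}` (identity theorem in jet form on the open convex set `T_{min ρ₁ ρ₂}`,
`JetLimit.eqOn_of_forall_iteratedDeriv_eq`). [folklore] -/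
theorem eqOn_thickening_min_of_forall_iteratedDeriv_eq {ρ₁ ρ₂ : ℝ} {g₁ g₂ : ℂ → ℂ}
    (hg₁ : DifferentiableOn ℂ g₁
      (Metric.thickening ρ₁ (((↑) : ℝ → ℂ) '' Set.Icc (1:ℝ) (Real.sqrt 2))))
    (hg₂ : DifferentiableOn ℂ g₂
      (Metric.thickening ρ₂ (((↑) : ℝ → ℂ) '' Set.Icc (1:ℝ) (Real.sqrt 2))))
    {z₀ : ℂ}
    (hz₀ : z₀ ∈ Metric.thickening (min ρ₁ ρ₂) (((↑) : ℝ → ℂ) '' Set.Icc (1:ℝ) (Real.sqrt 2)))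
    (h : ∀ n, iteratedDeriv n g₁ z₀ = iteratedDeriv n g₂ z₀) :
    EqOn g₁ g₂ (Metric.thickening (min ρ₁ ρ₂) (((↑) : ℝ → ℂ) '' Set.Icc (1:ℝ) (Real.sqrt 2))) :=
  JetLimit.eqOn_of_forall_iteratedDeriv_eq Metric.isOpen_thickening
    (JetLimit.isPreconnected_thickening_segment _)
    (hg₁.mono (Metric.thickening_mono (min_le_left _ _) _))
    (hg₂.mono (Metric.thickening_mono (min_le_right _ _) _)) hz₀ h

/-- **Abstract assembly (existence of a conformally invariant crossing limit).** Let
`P R δ : ℂ → ℂ` be any family such that (i) for every conformal rectangle `R` there are `ρ > 0`, `M`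
with `P R δ` holomorphic on `T_ρ` and bounded by `M` there for all small `δ > 0`; (ii) for every
`n` the `n`-th jet of `P R δ` at `√2` converges as `δ → 0⁺` to `c n η` for every uniformizing datum
of `R` of cross-ratio `η`; (iii) `P R δ 1` is the bond percolation crossing probability of `R` at
mesh `δ > 0`.  Then `JetLimitLemma` implies that the bond crossing probabilities of every conformal
rectangle converge to one function `f` of the cross-ratio: by (i), (ii) and `JetLimitLemma` the
crossing probabilities of `R` converge to `Re g_R(1)` for a holomorphic `g_R` on `T_ρ` with jets
`c n η` at `√2`, and by the identity theorem `g_R(1)` depends on `R` only through `η`.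
[folklore] -/
theorem exists_hasCrossingLimit_of_jets (P : ConformalRectangle → ℝ → ℂ → ℂ)
    (hP : ∀ R : ConformalRectangle, ∃ ρ > (0:ℝ), ∃ M : ℝ, ∀ᶠ δ in 𝓝[>] (0:ℝ),
      DifferentiableOn ℂ (P R δ)
          (Metric.thickening ρ (((↑) : ℝ → ℂ) '' Set.Icc (1:ℝ) (Real.sqrt 2))) ∧
        ∀ z ∈ Metric.thickening ρ (((↑) : ℝ → ℂ) '' Set.Icc (1:ℝ) (Real.sqrt 2)),
          ‖P R δ z‖ ≤ M)
    (c : ℕ → ℝ → ℂ)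
    (hc : ∀ (n : ℕ) (R : ConformalRectangle)
      (φ : ConformalEquiv UpperHalfPlane.upperHalfPlaneSet R.carrier) (x : Fin 4 → ℝ),
      R.IsUniformizing φ x →
        Tendsto (fun δ ↦ iteratedDeriv n (P R δ) (Real.sqrt 2 : ℂ)) (𝓝[>] 0)
          (𝓝 (c n (crossRatio x))))
    (hB : ∀ (R : ConformalRectangle) (δ : ℝ), 0 < δ →
      P R δ 1 = (bondDomainCrossingProb R δ : ℂ))
    (hJ : Theses.CardyQContinuation.JetLimitLemma) :
    ∃ f : ℝ → ℝ, ∀ R : ConformalRectangle, R.HasCrossingLimit (bondDomainCrossingProb R) f := by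
  unfold Theses.CardyQContinuation.JetLimitLemma at hJ
  -- Step A: for every `R` with a datum of cross-ratio `η`, a holomorphic `g` on some `T_ρ` with
  -- jets `c n η` at `√2` such that `bondDomainCrossingProb R δ → Re (g 1)`.
  have stepA : ∀ (R : ConformalRectangle)
      (φ : ConformalEquiv UpperHalfPlane.upperHalfPlaneSet R.carrier) (x : Fin 4 → ℝ),
      R.IsUniformizing φ x → ∃ ρ > (0:ℝ), ∃ g : ℂ → ℂ,
        DifferentiableOn ℂ g (Metric.thickening ρ (((↑) : ℝ → ℂ) '' Set.Icc (1:ℝ) (Real.sqrt 2))) ∧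
        (∀ n, iteratedDeriv n g (Real.sqrt 2 : ℂ) = c n (crossRatio x)) ∧
        Tendsto (bondDomainCrossingProb R) (𝓝[>] 0) (𝓝 (g 1).re) := by
    intro R φ x hx
    obtain ⟨ρ, hρ, M, hev⟩ := hP R
    obtain ⟨g, hg, hjet, hlim⟩ := hJ ρ hρ (P R) M (Real.sqrt 2 : ℂ) (fun n ↦ c n (crossRatio x))
      (sqrt_two_mem_thickening_segment hρ) hev (fun n ↦ hc n R φ x hx)
    refine ⟨ρ, hρ, g, hg, hjet, ?_⟩
    have h1 : Tendsto (fun δ ↦ P R δ 1) (𝓝[>] 0) (𝓝 (g 1)) :=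
      hlim 1 (one_mem_thickening_segment hρ)
    have hpos : ∀ᶠ δ in 𝓝[>] (0 : ℝ), 0 < δ := self_mem_nhdsWithin
    have h2 : Tendsto (fun δ ↦ (bondDomainCrossingProb R δ : ℂ)) (𝓝[>] 0) (𝓝 (g 1)) := by
      refine h1.congr' ?_
      filter_upwards [hpos] with δ hδ
      exact hB R δ hδ
    have h3 := (Complex.continuous_re.tendsto _).comp h2
    simpa [Function.comp_def] using h3
  -- Step B: two rectangles with data of the same cross-ratio have the same crossing limit.
  have stepB : ∀ (R R' : ConformalRectangle)
      (φ : ConformalEquiv UpperHalfPlane.upperHalfPlaneSet R.carrier) (x : Fin 4 → ℝ)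
      (φ' : ConformalEquiv UpperHalfPlane.upperHalfPlaneSet R'.carrier) (x' : Fin 4 → ℝ),
      R.IsUniformizing φ x → R'.IsUniformizing φ' x' → crossRatio x = crossRatio x' →
      ∃ L : ℝ, Tendsto (bondDomainCrossingProb R) (𝓝[>] 0) (𝓝 L) ∧
        Tendsto (bondDomainCrossingProb R') (𝓝[>] 0) (𝓝 L) := by
    intro R R' φ x φ' x' hx hx' hη
    obtain ⟨ρ, hρ, g, hg, hjet, hlim⟩ := stepA R φ x hx
    obtain ⟨ρ', hρ', g', hg', hjet', hlim'⟩ := stepA R' φ' x' hx'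
    have heq := eqOn_thickening_min_of_forall_iteratedDeriv_eq hg hg'
      (sqrt_two_mem_thickening_segment (lt_min hρ hρ')) fun n ↦ by rw [hjet n, hjet' n, hη]
    have h1 : g 1 = g' 1 := heq (one_mem_thickening_segment (lt_min hρ hρ'))
    refine ⟨(g 1).re, hlim, ?_⟩
    rw [h1]
    exact hlim'
  -- Step C: the common limit as a function `f` of the cross-ratio.
  classical
  refine ⟨fun η ↦
      if h : ∃ (R : ConformalRectangle)
          (φ : ConformalEquiv UpperHalfPlane.upperHalfPlaneSet R.carrier) (x : Fin 4 → ℝ),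
          R.IsUniformizing φ x ∧ crossRatio x = η
      then limUnder (𝓝[>] (0:ℝ)) (bondDomainCrossingProb h.choose) else 0, ?_⟩
  intro R' φ' x' hx'
  have h : ∃ (R : ConformalRectangle)
      (φ : ConformalEquiv UpperHalfPlane.upperHalfPlaneSet R.carrier) (x : Fin 4 → ℝ),
      R.IsUniformizing φ x ∧ crossRatio x = crossRatio x' := ⟨R', φ', x', hx', rfl⟩
  obtain ⟨φ₀, x₀, hx₀, hη₀⟩ := h.choose_spec
  obtain ⟨L, hL₀, hL'⟩ := stepB h.choose R' φ₀ x₀ φ' x' hx₀ hx' hη₀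
  have hfη : (fun η ↦
      if h : ∃ (R : ConformalRectangle)
          (φ : ConformalEquiv UpperHalfPlane.upperHalfPlaneSet R.carrier) (x : Fin 4 → ℝ),
          R.IsUniformizing φ x ∧ crossRatio x = η
      then limUnder (𝓝[>] (0:ℝ)) (bondDomainCrossingProb h.choose) else 0) (crossRatio x') =
      L := by
    dsimp only
    rw [dif_pos h]
    exact hL₀.limUnder_eq
  rw [hfη]
  exact hL'

end CardyQContinuationAssembly

open CardyQContinuationAssembly in
/-- **`Assembly`** (item stmt-CriticalPhenomena-5564 of route `CardyQContinuation`):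
`UniformZeroFree → IsingJetsConformal → BernoulliMatch → JetLimitLemma → CardyRigidity →
CardyFormulaZ2`.  `UniformZeroFree` supplies, for every conformal rectangle, a thickened segment
`T_ρ` on which the self-dual crossing ratio `P_δ = N_δ/Z_δ` (a quotient of polynomials in `s`,
`finite_powerset_edgeSet`) is holomorphic and bounded for all small `δ`; with the Ising jets
(`IsingJetsConformal`) and the Bernoulli end point (`BernoulliMatch`),
`exists_hasCrossingLimit_of_jets` gives through `JetLimitLemma` one function `f` of the
cross-ratio that is the crossing limit of every conformal rectangle, and `CardyRigidity`
identifies `f` with `cardyFunction` on `(0, 1)`, where the cross-ratio of every uniformizing datum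
lies (`crossRatio_mem_Ioo_of_isUniformizing`). [folklore] -/
theorem cardyQContinuation_assembly_proof : Theses.CardyQContinuation.Assembly := by
  unfold Theses.CardyQContinuation.Assembly
  intro hU hI hB hJ hR
  have hU' := hU
  dsimp only [Theses.CardyQContinuation.UniformZeroFree] at hU'
  have hI' := hI
  dsimp only [Theses.CardyQContinuation.IsingJetsConformal] at hI'
  have hB' := hB
  dsimp only [Theses.CardyQContinuation.BernoulliMatch] at hB'
  choose c hc using hI'
  have hR' := hR
  unfold Theses.CardyQContinuation.CardyRigidity at hR'
  -- the last step: a crossing limit `f` common to all rectangles is Cardy's `F` on `(0, 1)`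
  have final : ∀ f : ℝ → ℝ,
      (∀ R : ConformalRectangle, R.HasCrossingLimit (bondDomainCrossingProb R) f) →
        _root_.CardyFormulaZ2 := by
    intro f hf
    have hEq := hR' f hf
    show ∀ R : ConformalRectangle, R.HasCrossingLimit (bondDomainCrossingProb R) cardyFunction
    intro R φ x hx
    have hη := ConformalRectangle.crossRatio_mem_Ioo_of_isUniformizing hx
    rw [← hEq hη]
    exact hf R φ x hx
  refine (exists_hasCrossingLimit_of_jets _ ?_ c hc hB' hJ).elim final
  -- holomorphy and boundedness of `P_δ` on `T_ρ` from `UniformZeroFree`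
  intro R
  obtain ⟨ρ, hρ, M, hev⟩ := hU' R
  refine ⟨ρ, hρ, M, ?_⟩
  have hpos : ∀ᶠ δ in 𝓝[>] (0 : ℝ), 0 < δ := self_mem_nhdsWithin
  filter_upwards [hev, hpos] with δ hδ hδpos
  have hfin := finite_powerset_edgeSet R.isBounded hδpos
  refine ⟨?_, fun z hz => (hδ z hz).2⟩
  intro s hs
  refine DifferentiableAt.differentiableWithinAt ?_
  refine DifferentiableAt.div ?_ ?_ (hδ s hs).1
  · exact (differentiable_finsum_mem hfin fun ω => differentiable_indicator_pow _ _ ω) s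
  · exact (differentiable_finsum_mem hfin fun ω => differentiable_pow _) s

end Summit.CriticalPhenomena.CardyFormulaZ2.Theorems

end
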